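import Mathlib
import HarnessLib
import Summits.Ventures.LatticeQCDFlow.Exactness.SphereLatticeMoments
import Summits.Ventures.LatticeQCDFlow.Exactness.SphereHomogeneousLaplacian

/-!
# Fourth spherical moments on the lattice of spheres: `∫ ⟪a, x_n⟫⁴ dπ̄ = 3‖a‖⁴/(d(d+2))`, `Var(⟪a, x_n⟫²) = 2(d−1)‖a‖⁴/(d²(d+2))`, and the two-site moments `∫ ⟪x_k, U x_l⟫⁴ dπ̄`

HONEST FRAMING: exact (Metropolis-corrected) sampling algorithms for lattice gauge theory;
figures of merit are autocorrelation/cost numbers at stated couplings and volumes; no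
continuum-physics claim.

Venture `LatticeQCDFlow` (cell pub-lqcd), topic `Exactness`; FANOUT row 7 (`s0-cpn-null`).  NEW WORK
of the cell over the tree's `Exactness/SphereLatticeMoments.lean` (`∫∂̃_k·∂̃_k F dπ̄ = 0`, the second
moments `∫⟪a,x_n⟫⟪b,x_n⟫ dπ̄ = ⟪a,b⟫/d`, `∫⟪x_n, U x_m⟫² dπ̄`, rank-one quadratic site dependence)
and `Exactness/SphereHomogeneousLaplacian.lean` (the site operator on a positively homogeneous section:
`∂̃·∂̃ = Δq − n(n + d − 2)q`); nothing is cited as a fact ([folklore]: the moments of a coordinate of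
the uniform distribution on `S^{d−1}`, `E x₁² = 1/d`, `E x₁⁴ = 3/(d(d+2))`, here from the site Green
identity applied to the degree-4 harmonic decomposition of `⟪a,·⟫⁴`).  Use in this lineage's barrier
leg: the typed follow-up of `Exactness/SphereLOFlowEntropyFloorPairs.lean` — the conditional variance
`Var(E[V_j | ω_k, ω_l])` of the static block term given a coupled pair is, for isometric links on a
triangle-free graph, `4(2κ²/(d−1))²·Var(⟪x_k, U_kl x_l⟫²)`, and this file supplies
`Var(⟪x_k, U x_l⟫²) = 2(d−1)β⁴/(d²(d+2))` for `‖Uv‖ = β‖v‖`.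

## Content

* §1 `hasFDerivAt_inner_pow_four`, `fderiv_fderiv_inner_pow_four`, **`laplacian_inner_pow_four`**
  (`Δ⟪a,·⟫⁴ = 12‖a‖²⟪a,·⟫²`).
* §2 **`integral_slin_pow_four`** (`∫⟪a,x_n⟫⁴ dπ̄ = 3‖a‖⁴/(d(d+2))`), **`variance_slin_sq`**
  (`∫(⟪a,x_n⟫² − ‖a‖²/d)² dπ̄ = 2(d−1)‖a‖⁴/(d²(d+2))`).
* §3 **`integral_inner_clm_apply_pow_four`** (`k ≠ l`: `∫⟪x_k, U x_l⟫⁴ dπ̄ = (3/(d(d+2)))·∫‖U x_l‖⁴ dπ̄`),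
  **`integral_inner_clm_apply_pow_four_of_isometric`** (`= 3β⁴/(d(d+2))`),
  **`variance_sq_inner_clm_apply_of_isometric`** (`∫(⟪x_k,Ux_l⟫² − β²/d)² dπ̄ = 2(d−1)β⁴/(d²(d+2))`).

NOT CLAIMED: higher moments; anything about the flow.
-/

noncomputable section

namespace Summit.Ventures.LatticeQCDFlow.Exactness

open NormedSpace Filter Laplacian InnerProductSpace MeasureTheory Function Metric
open scoped RealInnerProductSpace Topology

variable {E : Type*} [NormedAddCommGroup E] [InnerProductSpace ℝ E]

/-! ## §1 Derivatives and the flat Laplacian of `⟪a,·⟫⁴` -/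

section Quartic

/-- The derivative of `y ↦ ⟪a, y⟫⁴`: `4⟪a,y⟫³·⟪a,·⟫`. -/
theorem hasFDerivAt_inner_pow_four (a y : E) :
    HasFDerivAt (fun z : E => ⟪a, z⟫ ^ 4) ((4 * ⟪a, y⟫ ^ 3) • (innerSL ℝ a : E →L[ℝ] ℝ)) y := by
  have h := ((innerSL ℝ a : E →L[ℝ] ℝ).hasFDerivAt (x := y)).pow 4
  simp only [innerSL_apply_apply] at h
  have e : (4 • ⟪a, y⟫ ^ (4 - 1) : ℝ) = 4 * ⟪a, y⟫ ^ 3 := by norm_num [nsmul_eq_mul]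
  rw [e] at h
  exact h

/-- The derivative of `y ↦ 4⟪a, y⟫³`: `12⟪a,y⟫²·⟪a,·⟫`. -/
theorem hasFDerivAt_four_mul_inner_pow_three (a y : E) :
    HasFDerivAt (fun z : E => 4 * ⟪a, z⟫ ^ 3) ((12 * ⟪a, y⟫ ^ 2) • (innerSL ℝ a : E →L[ℝ] ℝ)) y := by
  have h := (((innerSL ℝ a : E →L[ℝ] ℝ).hasFDerivAt (x := y)).pow 3).const_mul (4 : ℝ)
  simp only [innerSL_apply_apply, smul_smul] at h
  have e : ((4 : ℝ) * (3 • ⟪a, y⟫ ^ (3 - 1)) : ℝ) = 12 * ⟪a, y⟫ ^ 2 := by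
    norm_num [nsmul_eq_mul]; ring
  rw [e] at h
  exact h

/-- `fderiv` of `y ↦ ⟪a, y⟫⁴`, as a function. -/
theorem fderiv_inner_pow_four (a : E) :
    fderiv ℝ (fun z : E => ⟪a, z⟫ ^ 4) = fun y => (4 * ⟪a, y⟫ ^ 3) • (innerSL ℝ a : E →L[ℝ] ℝ) :=
  funext fun y => (hasFDerivAt_inner_pow_four a y).fderiv

/-- The second derivative of `y ↦ ⟪a, y⟫⁴`: `(u, w) ↦ 12⟪a,y⟫²⟪a,u⟫⟪a,w⟫`. -/
theorem fderiv_fderiv_inner_pow_four (a y u w : E) :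
    fderiv ℝ (fderiv ℝ (fun z : E => ⟪a, z⟫ ^ 4)) y u w = 12 * ⟪a, y⟫ ^ 2 * ⟪a, u⟫ * ⟪a, w⟫ := by
  rw [fderiv_inner_pow_four]
  have h := (hasFDerivAt_four_mul_inner_pow_three a y).smul_const (innerSL ℝ a : E →L[ℝ] ℝ)
  rw [h.fderiv]
  simp only [ContinuousLinearMap.smulRight_apply, smul_apply, innerSL_apply_apply, smul_eq_mul]

/-- `y ↦ ⟪a, y⟫⁴` is smooth. -/
theorem contDiff_inner_pow_four (a : E) {n : WithTop ℕ∞} : ContDiff ℝ n (fun z : E => ⟪a, z⟫ ^ 4) :=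
  (contDiff_const.inner ℝ contDiff_id).pow 4

variable [FiniteDimensional ℝ E]

/-- **The flat Laplacian of `⟪a,·⟫⁴`: `Δ⟪a,·⟫⁴(y) = 12‖a‖²⟪a,y⟫²`.** -/
theorem laplacian_inner_pow_four (a y : E) :
    Δ (fun z : E => ⟪a, z⟫ ^ 4) y = 12 * ‖a‖ ^ 2 * ⟪a, y⟫ ^ 2 := by
  rw [laplacian_eq_iteratedFDeriv_orthonormalBasis _ (stdOrthonormalBasis ℝ E)]
  simp only [iteratedFDeriv_two_apply, Matrix.cons_val_zero, Matrix.cons_val_one,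
    fderiv_fderiv_inner_pow_four]
  have h : ∀ i, 12 * ⟪a, y⟫ ^ 2 * ⟪a, stdOrthonormalBasis ℝ E i⟫ * ⟪a, stdOrthonormalBasis ℝ E i⟫ =
      12 * ⟪a, y⟫ ^ 2 * (⟪a, stdOrthonormalBasis ℝ E i⟫ * ⟪stdOrthonormalBasis ℝ E i, a⟫) := fun i => by
    rw [real_inner_comm (stdOrthonormalBasis ℝ E i) a]; ring
  simp only [h]
  rw [← Finset.mul_sum, (stdOrthonormalBasis ℝ E).sum_inner_mul_inner, real_inner_self_eq_norm_sq]
  ring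

end Quartic

/-! ## §2 The fourth moment of a linear statistic of one spin -/

section Moments

variable {Λ : Type*} [Fintype Λ] [DecidableEq Λ] [FiniteDimensional ℝ E] [MeasurableSpace E]
  [BorelSpace E] [Nontrivial E]

omit [Fintype Λ] [MeasurableSpace E] [BorelSpace E] [Nontrivial E] in
/-- **The site operator on a quartic section**: if `F(x[k ← y]) = ⟪a, y⟫⁴` with `a` not depending on
`x_k`, then `∂̃_k·∂̃_k F(x) = 12‖a‖²⟪a,x_k⟫² − 4(d + 2)⟪a,x_k⟫⁴` at `‖x_k‖ = 1`. -/
theorem siteLaplacian_of_inner_pow_four {F : (Λ → E) → ℝ} {x : Λ → E} {k : Λ} (hx : ‖x k‖ = 1) (a : E)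
    (h : ∀ y, F (update x k y) = ⟪a, y⟫ ^ 4) :
    siteLaplacian k F x = 12 * ‖a‖ ^ 2 * ⟪a, x k⟫ ^ 2 - 4 * ((Module.finrank ℝ E : ℝ) + 2) * ⟪a, x k⟫ ^ 4 := by
  have hq : ∀ t : ℝ, 0 < t → ∀ y : E, (fun z : E => ⟪a, z⟫ ^ 4) (t • y) = t ^ 4 * (fun z : E => ⟪a, z⟫ ^ 4) y := by
    intro t _ y; simp only [inner_smul_right]; ring
  have key := siteLaplacian_of_posHomogeneous_section (G := F) (x := x) (k := k) (n := 4) (c := 1) hx hq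
    (contDiff_inner_pow_four a) fun y => by rw [h, one_mul]
  rw [key, laplacian_inner_pow_four, one_mul]
  push_cast
  ring

/-- **THE FOURTH MOMENT: `∫ ⟪a, x_n⟫⁴ dπ̄ = 3‖a‖⁴/(d(d+2))`** (from `∫∂̃_n·∂̃_n F dπ̄ = 0` for
`F = ⟪a, x_n⟫⁴` and the second moment `∫⟪a,x_n⟫² dπ̄ = ‖a‖²/d`). -/
theorem integral_slin_pow_four (a : E) (n : Λ) :
    ∫ ω, ⟪a, ((ω : Λ → sphere (0 : E) 1) n : E)⟫ ^ 4
        ∂Measure.pi (fun _ : Λ => uniformSphere (volume : Measure E)) =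
      3 * ‖a‖ ^ 4 / ((Module.finrank ℝ E : ℝ) * ((Module.finrank ℝ E : ℝ) + 2)) := by
  have hd : (0 : ℝ) < (Module.finrank ℝ E : ℝ) := by exact_mod_cast Module.finrank_pos
  have hF : ContDiff ℝ 2 (fun x : Λ → E => ⟪a, x n⟫ ^ 4) :=
    (contDiff_const.inner ℝ (contDiff_apply ℝ E n)).pow 4
  have hlap : ∀ ω : Λ → sphere (0 : E) 1,
      siteLaplacian n (fun x : Λ → E => ⟪a, x n⟫ ^ 4) (fun m => (ω m : E)) =
        12 * ‖a‖ ^ 2 * ⟪a, ((ω n : sphere (0 : E) 1) : E)⟫ ^ 2 -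
          4 * ((Module.finrank ℝ E : ℝ) + 2) * ⟪a, ((ω n : sphere (0 : E) 1) : E)⟫ ^ 4 := fun ω => by
    have hx : ‖(fun m => ((ω m : sphere (0 : E) 1) : E)) n‖ = 1 := by simp
    exact siteLaplacian_of_inner_pow_four (F := fun x : Λ → E => ⟪a, x n⟫ ^ 4)
      (x := fun m => ((ω m : sphere (0 : E) 1) : E)) (k := n) hx a fun y => by simp only [update_self]
  have h0 := integral_siteLaplacian_uniform_eq_zero (Λ := Λ) hF n
  simp_rw [hlap] at h0
  have hi2 : Integrable (fun ω : Λ → sphere (0 : E) 1 => 12 * ‖a‖ ^ 2 * ⟪a, ((ω n : sphere (0 : E) 1) : E)⟫ ^ 2)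
      (Measure.pi fun _ : Λ => uniformSphere (volume : Measure E)) :=
    (integrable_pi_of_continuous _ (((continuous_const.inner
      (continuous_subtype_val.comp (continuous_apply n)))).pow 2)).const_mul _
  have hi4 : Integrable (fun ω : Λ → sphere (0 : E) 1 =>
      4 * ((Module.finrank ℝ E : ℝ) + 2) * ⟪a, ((ω n : sphere (0 : E) 1) : E)⟫ ^ 4)
      (Measure.pi fun _ : Λ => uniformSphere (volume : Measure E)) :=
    (integrable_pi_of_continuous _ (((continuous_const.inner
      (continuous_subtype_val.comp (continuous_apply n)))).pow 4)).const_mul _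
  rw [integral_sub hi2 hi4, integral_const_mul, integral_const_mul] at h0
  have h2 : ∫ ω, ⟪a, ((ω : Λ → sphere (0 : E) 1) n : E)⟫ ^ 2
      ∂Measure.pi (fun _ : Λ => uniformSphere (volume : Measure E)) = ‖a‖ ^ 2 / (Module.finrank ℝ E : ℝ) := by
    have h := integral_slin_mul_slin_same (Λ := Λ) a a n
    rw [real_inner_self_eq_norm_sq] at h
    rw [← h]
    exact integral_congr_ae (ae_of_all _ fun ω => by ring)
  rw [h2] at h0
  have hd2 : (Module.finrank ℝ E : ℝ) * ((Module.finrank ℝ E : ℝ) + 2) ≠ 0 := by positivity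
  rw [eq_div_iff hd2]
  field_simp at h0
  linarith

/-- **THE VARIANCE OF THE SQUARE: `∫ (⟪a, x_n⟫² − ‖a‖²/d)² dπ̄ = 2(d−1)‖a‖⁴/(d²(d+2))`.** -/
theorem variance_slin_sq (a : E) (n : Λ) :
    ∫ ω, (⟪a, ((ω : Λ → sphere (0 : E) 1) n : E)⟫ ^ 2 - ‖a‖ ^ 2 / (Module.finrank ℝ E : ℝ)) ^ 2
        ∂Measure.pi (fun _ : Λ => uniformSphere (volume : Measure E)) =
      2 * ((Module.finrank ℝ E : ℝ) - 1) * ‖a‖ ^ 4 /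
        ((Module.finrank ℝ E : ℝ) ^ 2 * ((Module.finrank ℝ E : ℝ) + 2)) := by
  have hd : (0 : ℝ) < (Module.finrank ℝ E : ℝ) := by exact_mod_cast Module.finrank_pos
  set μ : Measure (Λ → sphere (0 : E) 1) := Measure.pi (fun _ : Λ => uniformSphere (volume : Measure E))
    with hμ
  set m : ℝ := ‖a‖ ^ 2 / (Module.finrank ℝ E : ℝ) with hm
  have hc : Continuous fun ω : Λ → sphere (0 : E) 1 => ⟪a, ((ω n : sphere (0 : E) 1) : E)⟫ :=
    continuous_const.inner (continuous_subtype_val.comp (continuous_apply n))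
  have hi4 : Integrable (fun ω : Λ → sphere (0 : E) 1 => ⟪a, ((ω n : sphere (0 : E) 1) : E)⟫ ^ 4) μ :=
    integrable_pi_of_continuous _ (hc.pow 4)
  have hi2 : Integrable (fun ω : Λ → sphere (0 : E) 1 => 2 * m * ⟪a, ((ω n : sphere (0 : E) 1) : E)⟫ ^ 2) μ :=
    (integrable_pi_of_continuous _ (hc.pow 2)).const_mul _
  have hi42 : Integrable (fun ω : Λ → sphere (0 : E) 1 =>
      ⟪a, ((ω n : sphere (0 : E) 1) : E)⟫ ^ 4 - 2 * m * ⟪a, ((ω n : sphere (0 : E) 1) : E)⟫ ^ 2) μ := hi4.sub hi2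
  have e : ∀ ω : Λ → sphere (0 : E) 1, (⟪a, ((ω n : sphere (0 : E) 1) : E)⟫ ^ 2 - m) ^ 2 =
      ⟪a, ((ω n : sphere (0 : E) 1) : E)⟫ ^ 4 - 2 * m * ⟪a, ((ω n : sphere (0 : E) 1) : E)⟫ ^ 2 + m ^ 2 :=
    fun ω => by ring
  simp_rw [e]
  rw [integral_add hi42 (integrable_const _), integral_sub hi4 hi2, integral_const_mul, integral_const,
    smul_eq_mul, hμ, probReal_univ, one_mul, integral_slin_pow_four]
  have h2 : ∫ ω, ⟪a, ((ω : Λ → sphere (0 : E) 1) n : E)⟫ ^ 2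
      ∂Measure.pi (fun _ : Λ => uniformSphere (volume : Measure E)) = m := by
    have h := integral_slin_mul_slin_same (Λ := Λ) a a n
    rw [real_inner_self_eq_norm_sq] at h
    rw [hm, ← h]
    exact integral_congr_ae (ae_of_all _ fun ω => by ring)
  rw [h2, hm]
  field_simp
  ring

end Moments

/-! ## §3 Two sites: the fourth moment of the bond statistic `⟪x_k, U x_l⟫` -/

section TwoSites

variable {Λ : Type*} [Fintype Λ] [DecidableEq Λ] [FiniteDimensional ℝ E] [MeasurableSpace E]
  [BorelSpace E] [Nontrivial E]

/-- **`∫ ⟪x_k, U x_l⟫⁴ dπ̄ = (3/(d(d+2)))·∫ ‖U x_l‖⁴ dπ̄` for `k ≠ l`** (integrate the site `k` first: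
the section is `⟪U x_l, ·⟫⁴`). -/
theorem integral_inner_clm_apply_pow_four (U : E →L[ℝ] E) {k l : Λ} (hkl : k ≠ l) :
    ∫ ω, ⟪((ω : Λ → sphere (0 : E) 1) k : E), U ((ω l : E))⟫ ^ 4
        ∂Measure.pi (fun _ : Λ => uniformSphere (volume : Measure E)) =
      3 / ((Module.finrank ℝ E : ℝ) * ((Module.finrank ℝ E : ℝ) + 2)) *
        ∫ ω, ‖U (((ω : Λ → sphere (0 : E) 1) l : E))‖ ^ 4
          ∂Measure.pi (fun _ : Λ => uniformSphere (volume : Measure E)) := by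
  have hd : (0 : ℝ) < (Module.finrank ℝ E : ℝ) := by exact_mod_cast Module.finrank_pos
  set μ : Measure (Λ → sphere (0 : E) 1) := Measure.pi (fun _ : Λ => uniformSphere (volume : Measure E))
    with hμ
  -- the quartic section in `x_k`
  have hF : ContDiff ℝ 2 (fun x : Λ → E => ⟪x k, U (x l)⟫ ^ 4) :=
    ((contDiff_apply ℝ E k).inner ℝ (U.contDiff.comp (contDiff_apply ℝ E l))).pow 4
  have hlap : ∀ ω : Λ → sphere (0 : E) 1,
      siteLaplacian k (fun x : Λ → E => ⟪x k, U (x l)⟫ ^ 4) (fun m => (ω m : E)) =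
        12 * ‖U ((ω l : sphere (0 : E) 1) : E)‖ ^ 2 * ⟪U ((ω l : sphere (0 : E) 1) : E), ((ω k : sphere (0 : E) 1) : E)⟫ ^ 2 -
          4 * ((Module.finrank ℝ E : ℝ) + 2) * ⟪U ((ω l : sphere (0 : E) 1) : E), ((ω k : sphere (0 : E) 1) : E)⟫ ^ 4 := by
    intro ω
    have hx : ‖(fun m => ((ω m : sphere (0 : E) 1) : E)) k‖ = 1 := by simp
    exact siteLaplacian_of_inner_pow_four (F := fun x : Λ → E => ⟪x k, U (x l)⟫ ^ 4)
      (x := fun m => ((ω m : sphere (0 : E) 1) : E)) (k := k) hx (U ((ω l : sphere (0 : E) 1) : E))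
      fun y => by simp only [update_self, update_of_ne hkl.symm, real_inner_comm (U _)]
  have h0 := integral_siteLaplacian_uniform_eq_zero (Λ := Λ) hF k
  simp_rw [hlap] at h0
  have hcU : Continuous fun ω : Λ → sphere (0 : E) 1 => U (((ω l : sphere (0 : E) 1) : E)) :=
    U.continuous.comp (continuous_subtype_val.comp (continuous_apply l))
  have hck : Continuous fun ω : Λ → sphere (0 : E) 1 => (((ω k : sphere (0 : E) 1) : E)) :=
    continuous_subtype_val.comp (continuous_apply k)
  have hi2 : Integrable (fun ω : Λ → sphere (0 : E) 1 => 12 * ‖U ((ω l : sphere (0 : E) 1) : E)‖ ^ 2 *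
      ⟪U ((ω l : sphere (0 : E) 1) : E), ((ω k : sphere (0 : E) 1) : E)⟫ ^ 2) μ :=
    integrable_pi_of_continuous _ (((continuous_const.mul ((hcU.norm).pow 2)).mul ((hcU.inner hck).pow 2)))
  have hi4 : Integrable (fun ω : Λ → sphere (0 : E) 1 => 4 * ((Module.finrank ℝ E : ℝ) + 2) *
      ⟪U ((ω l : sphere (0 : E) 1) : E), ((ω k : sphere (0 : E) 1) : E)⟫ ^ 4) μ :=
    (integrable_pi_of_continuous _ ((hcU.inner hck).pow 4)).const_mul _
  rw [integral_sub hi2 hi4, integral_const_mul] at h0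
  -- the mixed term: `∫ ‖U x_l‖² ⟪U x_l, x_k⟫² = (1/d) ∫ ‖U x_l‖⁴` (rank-one quadratic section in `x_k`)
  have hG : ContDiff ℝ 2 (fun x : Λ → E => ‖U (x l)‖ ^ 2 * ⟪U (x l), x k⟫ ^ 2) :=
    ((U.contDiff.comp (contDiff_apply ℝ E l)).norm_sq ℝ).mul
      (((U.contDiff.comp (contDiff_apply ℝ E l)).inner ℝ (contDiff_apply ℝ E k)).pow 2)
  have hUc : Continuous fun x : Λ → E => U (x l) := U.continuous.comp (continuous_apply l)
  have hmix := integral_site_quadratic (Λ := Λ) hG k (fun x => ‖U (x l)‖ ^ 2 • U (x l)) (fun x => U (x l))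
    (((hUc.norm).pow 2).smul hUc) hUc fun x y => by
      simp only [update_self, update_of_ne hkl.symm, real_inner_smul_left]
      ring
  have hmix' : ∫ ω, 12 * ‖U (((ω : Λ → sphere (0 : E) 1) l : E))‖ ^ 2 *
      ⟪U ((ω l : sphere (0 : E) 1) : E), ((ω k : sphere (0 : E) 1) : E)⟫ ^ 2 ∂μ =
      12 / (Module.finrank ℝ E : ℝ) * ∫ ω, ‖U (((ω : Λ → sphere (0 : E) 1) l : E))‖ ^ 4 ∂μ := by
    have e1 : ∫ ω, 12 * ‖U (((ω : Λ → sphere (0 : E) 1) l : E))‖ ^ 2 *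
        ⟪U ((ω l : sphere (0 : E) 1) : E), ((ω k : sphere (0 : E) 1) : E)⟫ ^ 2 ∂μ =
        12 * ∫ ω, ‖U (((ω : Λ → sphere (0 : E) 1) l : E))‖ ^ 2 *
          ⟪U ((ω l : sphere (0 : E) 1) : E), ((ω k : sphere (0 : E) 1) : E)⟫ ^ 2 ∂μ := by
      rw [← integral_const_mul]
      exact integral_congr_ae (ae_of_all _ fun ω => by ring)
    have e2 : ∫ ω, ⟪‖U (((ω : Λ → sphere (0 : E) 1) l : E))‖ ^ 2 • U ((ω l : sphere (0 : E) 1) : E),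
        U ((ω l : sphere (0 : E) 1) : E)⟫ ∂μ = ∫ ω, ‖U (((ω : Λ → sphere (0 : E) 1) l : E))‖ ^ 4 ∂μ :=
      integral_congr_ae (ae_of_all _ fun ω => by
        simp only [real_inner_smul_left, real_inner_self_eq_norm_sq]; ring)
    simp only at hmix
    rw [← hμ] at hmix
    rw [e2] at hmix
    have e3 : ∫ ω, ‖U (((ω : Λ → sphere (0 : E) 1) l : E))‖ ^ 2 *
        ⟪U ((ω l : sphere (0 : E) 1) : E), ((ω k : sphere (0 : E) 1) : E)⟫ ^ 2 ∂μ =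
        (∫ ω, ‖U (((ω : Λ → sphere (0 : E) 1) l : E))‖ ^ 4 ∂μ) / (Module.finrank ℝ E : ℝ) := by
      rw [eq_div_iff hd.ne']; linarith [hmix]
    rw [e1, e3]; ring
  rw [hmix'] at h0
  -- conclude
  have e3 : ∫ ω, ⟪((ω : Λ → sphere (0 : E) 1) k : E), U ((ω l : E))⟫ ^ 4 ∂μ =
      ∫ ω, ⟪U (((ω : Λ → sphere (0 : E) 1) l : E)), ((ω k : sphere (0 : E) 1) : E)⟫ ^ 4 ∂μ :=
    integral_congr_ae (ae_of_all _ fun ω => by simp only; rw [real_inner_comm])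
  rw [e3]
  have hd2 : (Module.finrank ℝ E : ℝ) * ((Module.finrank ℝ E : ℝ) + 2) ≠ 0 := by positivity
  field_simp
  field_simp at h0
  linarith

omit [MeasurableSpace E] [BorelSpace E] [Nontrivial E] in
/-- For a scaled isometry `‖U v‖ = β‖v‖`: `Σ_i ‖U e_i‖² = d·β²` over an orthonormal basis. -/
theorem sum_norm_sq_apply_of_scaled_isometric (U : E →L[ℝ] E) {β : ℝ} (hU : ∀ v, ‖U v‖ = β * ‖v‖) :
    ∑ i, ‖U (stdOrthonormalBasis ℝ E i)‖ ^ 2 = (Module.finrank ℝ E : ℝ) * β ^ 2 := by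
  simp_rw [hU, (stdOrthonormalBasis ℝ E).orthonormal.1, mul_one]
  rw [Finset.sum_const, Finset.card_univ, Fintype.card_fin, nsmul_eq_mul]

/-- **Isometric links**: if `‖U v‖ = β‖v‖` for all `v`, then `∫ ⟪x_k, U x_l⟫⁴ dπ̄ = 3β⁴/(d(d+2))`. -/
theorem integral_inner_clm_apply_pow_four_of_isometric (U : E →L[ℝ] E) {β : ℝ} (hU : ∀ v, ‖U v‖ = β * ‖v‖)
    {k l : Λ} (hkl : k ≠ l) :
    ∫ ω, ⟪((ω : Λ → sphere (0 : E) 1) k : E), U ((ω l : E))⟫ ^ 4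
        ∂Measure.pi (fun _ : Λ => uniformSphere (volume : Measure E)) =
      3 * β ^ 4 / ((Module.finrank ℝ E : ℝ) * ((Module.finrank ℝ E : ℝ) + 2)) := by
  rw [integral_inner_clm_apply_pow_four U hkl]
  have e : ∀ ω : Λ → sphere (0 : E) 1, ‖U ((ω l : sphere (0 : E) 1) : E)‖ ^ 4 = β ^ 4 := fun ω => by
    rw [hU, norm_eq_of_mem_sphere (ω l), mul_one]
  simp_rw [e]
  rw [integral_const, smul_eq_mul, probReal_univ, one_mul]
  have hd2 : (Module.finrank ℝ E : ℝ) * ((Module.finrank ℝ E : ℝ) + 2) ≠ 0 := by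
    have hd : (0 : ℝ) < (Module.finrank ℝ E : ℝ) := by exact_mod_cast Module.finrank_pos
    positivity
  field_simp

/-- **The variance of the squared bond statistic for isometric links**:
`∫ (⟪x_k, U x_l⟫² − β²/d)² dπ̄ = 2(d−1)β⁴/(d²(d+2))` (`k ≠ l`, `‖Uv‖ = β‖v‖`). -/
theorem variance_sq_inner_clm_apply_of_isometric (U : E →L[ℝ] E) {β : ℝ} (hU : ∀ v, ‖U v‖ = β * ‖v‖)
    {k l : Λ} (hkl : k ≠ l) :
    ∫ ω, (⟪((ω : Λ → sphere (0 : E) 1) k : E), U ((ω l : E))⟫ ^ 2 - β ^ 2 / (Module.finrank ℝ E : ℝ)) ^ 2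
        ∂Measure.pi (fun _ : Λ => uniformSphere (volume : Measure E)) =
      2 * ((Module.finrank ℝ E : ℝ) - 1) * β ^ 4 /
        ((Module.finrank ℝ E : ℝ) ^ 2 * ((Module.finrank ℝ E : ℝ) + 2)) := by
  have hd : (0 : ℝ) < (Module.finrank ℝ E : ℝ) := by exact_mod_cast Module.finrank_pos
  set μ : Measure (Λ → sphere (0 : E) 1) := Measure.pi (fun _ : Λ => uniformSphere (volume : Measure E))
    with hμ
  set m : ℝ := β ^ 2 / (Module.finrank ℝ E : ℝ) with hm
  have hc : Continuous fun ω : Λ → sphere (0 : E) 1 => ⟪((ω k : sphere (0 : E) 1) : E), U ((ω l : E))⟫ :=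
    (continuous_subtype_val.comp (continuous_apply k)).inner
      (U.continuous.comp (continuous_subtype_val.comp (continuous_apply l)))
  have hi4 : Integrable (fun ω : Λ → sphere (0 : E) 1 => ⟪((ω k : sphere (0 : E) 1) : E), U ((ω l : E))⟫ ^ 4) μ :=
    integrable_pi_of_continuous _ (hc.pow 4)
  have hi2 : Integrable (fun ω : Λ → sphere (0 : E) 1 =>
      2 * m * ⟪((ω k : sphere (0 : E) 1) : E), U ((ω l : E))⟫ ^ 2) μ :=
    (integrable_pi_of_continuous _ (hc.pow 2)).const_mul _
  have hi42 : Integrable (fun ω : Λ → sphere (0 : E) 1 =>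
      ⟪((ω k : sphere (0 : E) 1) : E), U ((ω l : E))⟫ ^ 4 -
        2 * m * ⟪((ω k : sphere (0 : E) 1) : E), U ((ω l : E))⟫ ^ 2) μ := hi4.sub hi2
  have e : ∀ ω : Λ → sphere (0 : E) 1, (⟪((ω k : sphere (0 : E) 1) : E), U ((ω l : E))⟫ ^ 2 - m) ^ 2 =
      ⟪((ω k : sphere (0 : E) 1) : E), U ((ω l : E))⟫ ^ 4 -
        2 * m * ⟪((ω k : sphere (0 : E) 1) : E), U ((ω l : E))⟫ ^ 2 + m ^ 2 := fun ω => by ring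
  simp_rw [e]
  rw [integral_add hi42 (integrable_const _), integral_sub hi4 hi2, integral_const_mul, integral_const,
    smul_eq_mul, hμ, probReal_univ, one_mul, integral_inner_clm_apply_pow_four_of_isometric U hU hkl,
    integral_sq_inner_clm_apply U hkl, sum_norm_sq_apply_of_scaled_isometric U hU, hm]
  field_simp
  ring

end TwoSites

end Summit.Ventures.LatticeQCDFlow.Exactness

end
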